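import Literature.MathematicalPhysics.QuantumFieldTheory.ConformalBootstrap3D.PointKernelK57Data
import Literature.MathematicalPhysics.QuantumFieldTheory.ConformalBootstrap3D.PointKernelParts

/-!
# K57 certificate, kernel part file P15: one-cell head segments 152 in level ranges

The head cells whose kernel evaluation exceeds one `decide` are one-cell segments of `hsegsK57`; each is
checked by `PCert.hPartSideOK` (side conditions) and `PCert.hPartOK` per level range `[n_lo, n_lo + count)`
against an integer claim, the claims summing to `≥ 0` (`PointKernel.partsOK`); soundness is
`PCert.hParts_sound` (`PointKernelParts`).  The part files `P1, P2, …` are mutually independent (each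
imports only the data file); the ranges of one cell may span several of them, and the per-cell
conclusions `hparts_i` / `hcell_i` of those cells are assembled in `PointKernelK57.lean`.
Estimated kernel time 202 s.
-/

set_option maxRecDepth 100000
set_option maxHeartbeats 0

namespace Literature.MathematicalPhysics.QuantumFieldTheory.ConformalBootstrap3D.PointKernelK57

open Literature.MathematicalPhysics.QuantumFieldTheory.ConformalBootstrap3D.PointKernel

/-- levels `[0, 26)` of segment 152: partial lower sum `≥` claim. [folklore] -/
theorem part_152_0 : certK57.hPartOK (PCert.segAt hsegsK57 152) JHK57 0 26 (-10617676240923719509778992394707783310) = true := by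
  decide +kernel

/-- levels `[26, 37)` of segment 152: partial lower sum `≥` claim. [folklore] -/
theorem part_152_1 : certK57.hPartOK (PCert.segAt hsegsK57 152) JHK57 26 11 (8100924476996262562938649712863036310) = true := by
  decide +kernel

/-- levels `[37, 45)` of segment 152: partial lower sum `≥` claim. [folklore] -/
theorem part_152_2 : certK57.hPartOK (PCert.segAt hsegsK57 152) JHK57 37 8 (2111538703683244416702970861998609889) = true := by
  decide +kernel

/-- levels `[45, 49)` of segment 152: partial lower sum `≥` claim. [folklore] -/
theorem part_152_3 : certK57.hPartOK (PCert.segAt hsegsK57 152) JHK57 45 4 (405213060244212530137371819846137112) = true := by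
  decide +kernel

end Literature.MathematicalPhysics.QuantumFieldTheory.ConformalBootstrap3D.PointKernelK57
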